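import Summits.QuantumFields.YangMills.Theorems.SwapVirialDeficitBlowUpRingPaths
import HarnessLib

/-!
# The PERIODIC massive-mode rung, brick PM-0b: the quaternion history of the rebuilt ring is `C^n` in ANY number of parameters
# (free-hands support of ⟨stmt-QuantumFields-24196⟩ `SwapVirialDeficit.ToronSoftnessSharp`; LEAD memo `sfw-p2-g96-memo-24196-PM-design.md` §3 PM-0b;
# multi-parameter ∕ `ContDiffOn` form of w2 g57's ✓`BlowUpRing.contDiff_quatHistory_ringConfig` (which is the case `E = ℝ`, `S = univ`))

The two-scale limit of the periodic fibre (brick PM of w3 g64's memo `w3-g64-memo-24196-periodic-massive-mode-rung.md`) is a JOINT limit in the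
two blow-up parameters `(u, s) = (ρ, t/ρ²)` and is taken locally uniformly in the hub coordinate `a₀` and continuously in the blow-up point; its
structure theorem `G = u⁴s²·Φ` (LEAD memo §1) needs the deficit of the rebuilt ring history to be `C^n` JOINTLY in `(u, s, a₀, w', y)`, i.e. in a
parameter ranging over a general normed space `E`, and only on the open set where the raw letters are non-zero.  w2 g57's §1 «Words» is stated
for one real parameter `t : ℝ` and global `ContDiff`; its proof is purely algebraic (every link ∕ site of `fixHistory (ringConfig χ (C, U))` is a word of
length `≤ 3` in the leaders, the followers and the constant `χ`, ✓`su2Quat_mul`), so it generalises verbatim: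
* §1 ★ `contDiffOn_su2Quat_fixHistory_fst_param` ∕ `…_snd_param` ∕ ★★ `contDiffOn_quatHistory_ringConfig_param`: if `p ↦ su2Quat (C p μ)` (`μ : Fin 4`)
  and `p ↦ su2Quat (U p i)` (`i : Fol L`) are `C^n` on `S ⊆ E`, so is every link ∕ site quaternion of `fixHistory (ringConfig χ (C p, U p))` and the
  whole quaternion history as one map into `(Fin (2L−1+1) → Edge 3 L → ℍ) × (Site 3 L → ℍ)`;
* §2 ★ `contDiffOn_su2Quat_quatToSU2_comp` — `p ↦ su2Quat (quatToSU2 (φ p))` is `C^n` on `S` if `φ : E → ℍ` is and `φ ≠ 0` on `S`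
  (✓`su2Quat_quatToSU2_eq_radialUnit`, ✓`contDiffAt_radialUnit`): the RAW-LETTER form in which the two-scale chart is polynomial;
* §3 ★★ `contDiffOn_chartDeficit_param` — the σ-glued deficit `p ↦ chartDeficit L z χ (C p, U p)` is `C^n` on `S` (✓`swapRingDeficit_eq_qDeficit`,
  ✓`contDiff_qDeficit`); the periodic twin waits for `periodicQDeficit` (PM-0a) and is one line from §1 in the same way.
HONEST LABEL: calculus bookkeeping (plumbing for a plan-level fixed-`L` rung of a DRAFT line); nothing of PM, ⟨24196⟩ or ⟨24197⟩ is proved; own crux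
⟨22884⟩ OPEN (blocked-on ⟨19935⟩); the Yang–Mills mass gap is NOT proved; no summit is proved by a line.
THEOREMS ONLY (0 `def`, 0 `sorry`), standard axioms.  LEAD seat ym-line-sfw-p2 g96 (cell ym-idea-1, free hands), `--supports stmt-QuantumFields-24196`.
References: [cite: Luscher1983, §2]; [folklore].
-/

set_option autoImplicit false

noncomputable section

open Quaternion Set Filter Topology
open scoped Quaternion BigOperators ContDiff
open Literature.MathematicalPhysics.QuantumLattice
open Literature.MathematicalPhysics.QuantumFieldTheory hiding SU2
open Summit.QuantumFields.YangMills.Theorems.SwapTwistDeficit.ToronLog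

namespace Summit.QuantumFields.YangMills.Theorems.SwapVirialDeficit.BlowUpRing

open Summit.QuantumFields.YangMills.Theorems.FemtoTransferGap
open Summit.QuantumFields.YangMills.Theorems.FemtoTransferGap.TT
open Summit.QuantumFields.YangMills.Theorems.SwapVirialDeficit.SwapRing (swapRingDeficit)
open Literature.Analysis.Calculus (radialUnit)
open Summit.QuantumFields.YangMills.Theorems.SwapVirialDeficit.ZeroModeSigma (su2Quat_quatToSU2_eq_radialUnit)
open Summit.QuantumFields.YangMills.Theorems.SwapVirialDeficit.BlowUp (qDeficit contDiff_qDeficit swapRingDeficit_eq_qDeficit contDiffAt_radialUnit)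

variable {L : ℕ} [NeZero L]

/-! ## §1 Words: the quaternion history is `C^n` on `S` in a parameter `p : E` -/

section Words

variable {E : Type*} [NormedAddCommGroup E] [NormedSpace ℝ E] {n : ℕ∞} {S : Set E} {C : E → Fin 4 → SU2} {U : E → Fol L → SU2}

omit [NeZero L] in
/-- The letter quaternion `p ↦ su2Quat (letter (C p ∘ castSucc) i)` is `C^n` on `S` if the leaders are. [folklore] -/
theorem contDiffOn_su2Quat_letter_param (hC : ∀ μ : Fin 4, ContDiffOn ℝ n (fun p => su2Quat (C p μ)) S) (i : OffIdx L) :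
    ContDiffOn ℝ n (fun p => su2Quat (letter (fun μ => C p (Fin.castSucc μ)) i)) S := by
  by_cases h : i.1.1 i.1.2 = -1
  · simp only [letter, h, if_true]; exact hC _
  · simp only [letter, h, if_false, su2Quat_one]; exact contDiffOn_const

/-- ★ Slice-`0` quaternions are `C^n` on `S`: leaders verbatim, other links `letter · U`. [folklore] -/
theorem contDiffOn_su2Quat_ringConfig_fst_param (χ : Site 3 L → SU2) (hC : ∀ μ : Fin 4, ContDiffOn ℝ n (fun p => su2Quat (C p μ)) S)
    (hU : ∀ i : Fol L, ContDiffOn ℝ n (fun p => su2Quat (U p i)) S) (i : OffIdx L) :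
    ContDiffOn ℝ n (fun p => su2Quat ((ringConfig χ (C p, U p)).1 i)) S := by
  by_cases h : isLead i = true
  · simp only [ringConfig_fst_of_isLead χ _ h]; exact hC _
  · have e : (fun p => su2Quat ((ringConfig χ (C p, U p)).1 i)) =
        fun p => su2Quat (letter (fun μ => C p (Fin.castSucc μ)) i) * su2Quat (U p (Sum.inl ⟨i, h⟩)) := by
      funext p
      rw [← su2Quat_mul]
      exact congrArg su2Quat (ringConfig_fst_of_not_isLead χ (C p, U p) ⟨i, h⟩)
    rw [e]
    exact (contDiffOn_su2Quat_letter_param hC i).mul (hU _)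

/-- ★ Glued slice-`0` quaternions are `C^n` on `S`. [folklore] -/
theorem contDiffOn_su2Quat_glue_ringConfig_param (χ : Site 3 L → SU2) (hC : ∀ μ : Fin 4, ContDiffOn ℝ n (fun p => su2Quat (C p μ)) S)
    (hU : ∀ i : Fol L, ContDiffOn ℝ n (fun p => su2Quat (U p i)) S) (e : Edge 3 L) :
    ContDiffOn ℝ n (fun p => su2Quat (glue (ringConfig χ (C p, U p)).1 e)) S := by
  by_cases h : treeEdge e = true
  · simp only [su2Quat_glue, h, dif_pos]; exact contDiffOn_const
  · simp only [su2Quat_glue, h]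
    exact contDiffOn_su2Quat_ringConfig_fst_param χ hC hU ⟨e, h⟩

/-- ★ Slice-`j` quaternions (`j ≥ 1`) are `C^n` on `S`: `glue(w) e · U_(j,e)`. [folklore] -/
theorem contDiffOn_su2Quat_ringConfig_snd_fst_param (χ : Site 3 L → SU2) (hC : ∀ μ : Fin 4, ContDiffOn ℝ n (fun p => su2Quat (C p μ)) S)
    (hU : ∀ i : Fol L, ContDiffOn ℝ n (fun p => su2Quat (U p i)) S) (j : Fin (2 * L - 1)) (e : Edge 3 L) :
    ContDiffOn ℝ n (fun p => su2Quat ((ringConfig χ (C p, U p)).2.1 j e)) S := by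
  have e' : (fun p => su2Quat ((ringConfig χ (C p, U p)).2.1 j e)) =
      fun p => su2Quat (glue (ringConfig χ (C p, U p)).1 e) * su2Quat (U p (Sum.inr (Sum.inl (j, e)))) := by
    funext p; rw [ringConfig_snd_fst, su2Quat_mul]
  rw [e']
  exact (contDiffOn_su2Quat_glue_ringConfig_param χ hC hU e).mul (hU _)

/-- ★ Seam quaternions are `C^n` on `S`: `c` at the origin, `χ(x)·c·U_x` elsewhere. [folklore] -/
theorem contDiffOn_su2Quat_ringConfig_snd_snd_param (χ : Site 3 L → SU2) (hC : ∀ μ : Fin 4, ContDiffOn ℝ n (fun p => su2Quat (C p μ)) S)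
    (hU : ∀ i : Fol L, ContDiffOn ℝ n (fun p => su2Quat (U p i)) S) (x : Site 3 L) :
    ContDiffOn ℝ n (fun p => su2Quat ((ringConfig χ (C p, U p)).2.2 x)) S := by
  by_cases h : x = 0
  · subst h
    simp only [ringConfig_snd_snd_zero]; exact hC _
  · have e : (fun p => su2Quat ((ringConfig χ (C p, U p)).2.2 x)) =
        fun p => su2Quat (χ x) * su2Quat (C p (Fin.last 3)) * su2Quat (U p (Sum.inr (Sum.inr ⟨x, h⟩))) := by
      funext p
      rw [← su2Quat_mul, ← su2Quat_mul]
      exact congrArg su2Quat (ringConfig_snd_snd_of_ne χ (C p, U p) ⟨x, h⟩)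
    rw [e]
    exact (contDiffOn_const.mul (hC _)).mul (hU _)

/-- ★ Every link quaternion of the rebuilt ring history is `C^n` on `S` (slice `0` = `glue w`, slices `j ≥ 1` = `r_j`). [folklore] -/
theorem contDiffOn_su2Quat_fixHistory_fst_param (χ : Site 3 L → SU2) (hC : ∀ μ : Fin 4, ContDiffOn ℝ n (fun p => su2Quat (C p μ)) S)
    (hU : ∀ i : Fol L, ContDiffOn ℝ n (fun p => su2Quat (U p i)) S) (i : Fin (2 * L - 1 + 1)) (e : Edge 3 L) :
    ContDiffOn ℝ n (fun p => su2Quat ((fixHistory (ringConfig χ (C p, U p))).1 i e)) S := by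
  refine Fin.cases ?_ (fun j => ?_) i
  · simp only [fixHistory, Fin.cons_zero]; exact contDiffOn_su2Quat_glue_ringConfig_param χ hC hU e
  · simp only [fixHistory, Fin.cons_succ]; exact contDiffOn_su2Quat_ringConfig_snd_fst_param χ hC hU j e

/-- ★ Every seam quaternion of the rebuilt ring history is `C^n` on `S`. [folklore] -/
theorem contDiffOn_su2Quat_fixHistory_snd_param (χ : Site 3 L → SU2) (hC : ∀ μ : Fin 4, ContDiffOn ℝ n (fun p => su2Quat (C p μ)) S)
    (hU : ∀ i : Fol L, ContDiffOn ℝ n (fun p => su2Quat (U p i)) S) (x : Site 3 L) :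
    ContDiffOn ℝ n (fun p => su2Quat ((fixHistory (ringConfig χ (C p, U p))).2 x)) S :=
  contDiffOn_su2Quat_ringConfig_snd_snd_param χ hC hU x

/-- ★★ **THE QUATERNION HISTORY IS `C^n` ON `S` IN THE PARAMETER `p : E`** (any normed space `E`; `E = ℝ`, `S = univ` is w2 g57's
✓`contDiff_quatHistory_ringConfig`). [folklore] -/
theorem contDiffOn_quatHistory_ringConfig_param (χ : Site 3 L → SU2) (hC : ∀ μ : Fin 4, ContDiffOn ℝ n (fun p => su2Quat (C p μ)) S)
    (hU : ∀ i : Fol L, ContDiffOn ℝ n (fun p => su2Quat (U p i)) S) :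
    ContDiffOn ℝ n (fun p => ((fun (i : Fin (2 * L - 1 + 1)) (e : Edge 3 L) => su2Quat ((fixHistory (ringConfig χ (C p, U p))).1 i e)),
      (fun x : Site 3 L => su2Quat ((fixHistory (ringConfig χ (C p, U p))).2 x))) :
        E → (Fin (2 * L - 1 + 1) → Edge 3 L → ℍ) × (Site 3 L → ℍ)) S := by
  refine ContDiffOn.prodMk ?_ ?_
  · exact contDiffOn_pi.2 fun i => contDiffOn_pi.2 fun e => contDiffOn_su2Quat_fixHistory_fst_param χ hC hU i e
  · exact contDiffOn_pi.2 fun x => contDiffOn_su2Quat_fixHistory_snd_param χ hC hU x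

end Words

/-! ## §2 Raw letters: `p ↦ su2Quat (quatToSU2 (φ p))` is `C^n` where `φ ≠ 0` -/

section Raw

variable {E : Type*} [NormedAddCommGroup E] [NormedSpace ℝ E] {n : ℕ∞} {S : Set E}

/-- ★ **Normalised raw letters are `C^n`**: if `φ : E → ℍ` is `C^n` on `S` and `φ p ≠ 0` on `S`, then `p ↦ su2Quat (quatToSU2 (φ p)) = φ p/‖φ p‖` is `C^n`
on `S` (✓`su2Quat_quatToSU2_eq_radialUnit`, ✓`contDiffAt_radialUnit`).  In the two-scale chart every raw letter `φ` is polynomial in the parameters. [folklore] -/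
theorem contDiffOn_su2Quat_quatToSU2_comp {φ : E → ℍ} (hφ : ContDiffOn ℝ n φ S) (h0 : ∀ p ∈ S, φ p ≠ 0) :
    ContDiffOn ℝ n (fun p => su2Quat (quatToSU2 (φ p))) S := by
  have e : ∀ p ∈ S, su2Quat (quatToSU2 (φ p)) = radialUnit (φ p) := fun p hp => su2Quat_quatToSU2_eq_radialUnit (h0 p hp)
  refine ContDiffOn.congr ?_ e
  intro p hp
  exact ((contDiffAt_radialUnit (n := n) (h0 p hp)).contDiffWithinAt).comp p (hφ p hp) (Set.mapsTo_univ _ _)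

/-- The global form: `φ` `C^n` and nowhere zero ⟹ `su2Quat ∘ quatToSU2 ∘ φ` is `C^n`. [folklore] -/
theorem contDiff_su2Quat_quatToSU2_comp {φ : E → ℍ} (hφ : ContDiff ℝ n φ) (h0 : ∀ p, φ p ≠ 0) :
    ContDiff ℝ n (fun p => su2Quat (quatToSU2 (φ p))) := by
  rw [← contDiffOn_univ] at hφ ⊢
  exact contDiffOn_su2Quat_quatToSU2_comp hφ fun p _ => h0 p

end Raw

/-! ## §3 The σ-glued deficit in a parameter -/

section Deficit

variable {E : Type*} [NormedAddCommGroup E] [NormedSpace ℝ E] {n : ℕ∞} {S : Set E} {C : E → Fin 4 → SU2} {U : E → Fol L → SU2}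

/-- ★★ **THE σ-GLUED DEFICIT IS `C^n` ON `S` IN THE PARAMETER**: `p ↦ chartDeficit L z χ (C p, U p)` (✓`swapRingDeficit_eq_qDeficit` ∘ §1).
With `E = ℝ` and the blow-up letter paths this is fcl-p3 g45's ✓`contDiff_chartDeficit_blowUpPoint`. [cite: Luscher1983, §2] -/
theorem contDiffOn_chartDeficit_param (z : Fin 3 → Bool) (χ : Site 3 L → SU2) (hC : ∀ μ : Fin 4, ContDiffOn ℝ n (fun p => su2Quat (C p μ)) S)
    (hU : ∀ i : Fol L, ContDiffOn ℝ n (fun p => su2Quat (U p i)) S) :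
    ContDiffOn ℝ n (fun p => chartDeficit L z χ (C p, U p)) S := by
  have e : (fun p => chartDeficit L z χ (C p, U p)) = fun p =>
      qDeficit z ((fun i e => su2Quat ((fixHistory (ringConfig χ (C p, U p))).1 i e),
        fun x => su2Quat ((fixHistory (ringConfig χ (C p, U p))).2 x)) :
          (Fin (2 * L - 1 + 1) → Edge 3 L → ℍ) × (Site 3 L → ℍ)) := by
    funext p
    exact swapRingDeficit_eq_qDeficit z _
  rw [e]
  exact (contDiff_qDeficit (L := L) (n := n) z).comp_contDiffOn (contDiffOn_quatHistory_ringConfig_param χ hC hU)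

/-- The global form (`S = univ`). [cite: Luscher1983, §2] -/
theorem contDiff_chartDeficit_param (z : Fin 3 → Bool) (χ : Site 3 L → SU2) (hC : ∀ μ : Fin 4, ContDiff ℝ n (fun p => su2Quat (C p μ)))
    (hU : ∀ i : Fol L, ContDiff ℝ n (fun p => su2Quat (U p i))) :
    ContDiff ℝ n (fun p => chartDeficit L z χ (C p, U p)) := by
  rw [← contDiffOn_univ]
  exact contDiffOn_chartDeficit_param z χ (fun μ => (hC μ).contDiffOn) (fun i => (hU i).contDiffOn)

end Deficit

end Summit.QuantumFields.YangMills.Theorems.SwapVirialDeficit.BlowUpRing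

end
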